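import Summits.RiemannHypothesis.RiemannHypothesis.Theorems.NymanBeurlingQDigitsKernel
import Summits.RiemannHypothesis.RiemannHypothesis.Theorems.NymanBeurlingDilateZeroSumExplicit
import Literature.Analysis.SpecialFunctions.KernelLog
import Literature.Analysis.SpecialFunctions.LogPiBounds
import Literature.Analysis.SpecialFunctions.EulerMascheroniSharpBounds
import Mathlib.NumberTheory.ArithmeticFunction.VonMangoldt
import HarnessLib

/-!
# RiemannHypothesis / Nyman–Beurling — `κ_∞` in the kernel, I: interval enclosures of `Λ`, `m_n` and the prime side `S(n)`

Column LI/NB, rung L-P(P2), PROOF-OF-DATA for cell `pub/rh-li` [rh-li-eng-3 g5].  Kernel-evaluable outward-rounded fixed-point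
(scale `2⁸⁰`) enclosures: `lamIv m ∋ Λ(m)` (Mathlib's `IsPrimePow`/`minFac` evaluated by the kernel, `log` by the tree's
`KernelLog.logIv`), `mIv n ∋ m_n` (`log1pIv`), `pIv ∋ nbDilatePrimeSide n` from enclosures of `Σ_{m≤n}Λ(m)/m`, `Σ_{m≤n}Λ(m)` and
`logIv (n−1), logIv n, logIv (n+1)` (`nbDilatePrimeSide_eq_logs`); the single-pass state machine `step`/`run` accumulating
`X_n = Σ_{j=2}^{n} (m_j − m_{j−1})·nbDilatePrimeSide j`.  Soundness: `lamIv_sound`, `mIv_sound`, `pIv_sound` (this file),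
`run_sound` and the Boolean test in part II (`NymanBeurlingKappaKernelRun.lean`), the real-number bracket in part III
(`NymanBeurlingKappaPredicted.lean`).  RH-FREE [rh-li-eng-3 g5]: certified numerics; nothing here bears on the truth of RH.
-/

noncomputable section

set_option linter.dupNamespace false

open Filter Set Finset
open scoped Real

namespace Summit.RiemannHypothesis.RiemannHypothesis.Theorems.NbTheory

open Literature.NumberTheory.LFunctions Literature.Analysis.SpecialFunctions.KernelLog

namespace KappaCert

/-- Scaled integer constants (outward, scale `2⁸⁰`): `GLO = ⌊0.5772156649015328 · 2⁸⁰⌋ ≤ 2⁸⁰γ`, etc.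
(`γ` to 16 decimals, `log 2π = log 2 + log π` to 20, tree). -/
def GLO : ℤ := 697810920785488682341268
/-- see `GLO` (`= ⌈0.5772156649015405 · 2⁸⁰⌉`) -/
def GHI : ℤ := 697810920785497991070080
/-- see `GLO` (`= ⌊(0.69314718055994530940 + 1.14472988584940017414) · 2⁸⁰⌋`) -/
def L2PILO : ℤ := 2221857038859848242481129
/-- see `GLO` (`= ⌈(0.69314718055994530944 + 1.14472988584940017415) · 2⁸⁰⌉`) -/
def L2PIHI : ℤ := 2221857038859848242541576

/-- Enclosure of `2⁸⁰·Λ(m)` (`0` unless `m` is a prime power, then `log (minFac m)` by `logIv`). -/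
def lamIv (m : ℕ) : Option (ℤ × ℤ) :=
  if IsPrimePow m then logIv (Nat.minFac m) else some (0, 0)

/-- Enclosure of `2⁸⁰·m_n`: `n = 1` from `logIv 2` (`m_1 = 2 log 2 − 1`), `n ≥ 2` from `log1pIv 1 n`. -/
def mIv (n : ℕ) : Option (ℤ × ℤ) :=
  if n = 1 then
    match logIv 2 with
    | some (l, h) => some (2 * l - LOGSC, 2 * h - LOGSC)
    | none => none
  else
    match log1pIv 1 n with
    | some (l, h) => some (((n : ℤ) * (n + 1)) * l - n * LOGSC, ((n : ℤ) * (n + 1)) * h - n * LOGSC)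
    | none => none

/-- Enclosure of `2⁸⁰·nbDilatePrimeSide n` (`n ≥ 2`) from enclosures of `A = Σ_{m≤n} Λ(m)/m`, `Ψ = Σ_{m≤n} Λ(m)`. -/
def pIv (n : ℕ) (Alo Ahi Plo Phi : ℤ) : Option (ℤ × ℤ) :=
  match logIv (n - 1), logIv n, logIv (n + 1) with
  | some (al, ah), some (bl, bh), some (cl, ch) =>
    some (Alo - bh + GLO - (-((-Phi) / (n : ℤ))) + LOGSC + (LOGSC - L2PIHI) / (n : ℤ)
        - (-((-(ah + ch - 2 * bl)) / (2 * (n : ℤ)))) - (-((-(ch - al)) / 2)),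
      Ahi - bl + GHI - (Plo / (n : ℤ)) + LOGSC + (-((-(LOGSC - L2PILO)) / (n : ℤ)))
        - ((al + cl - 2 * bh) / (2 * (n : ℤ))) - ((cl - ah) / 2))
  | _, _, _ => none

/-- The single-pass state after index `n`: `(Alo, Ahi, Ψlo, Ψhi, mlo, mhi, Xlo, Xhi)` enclosing (scale `2⁸⁰`)
`Σ_{m≤n} Λ(m)/m`, `Σ_{m≤n} Λ(m)`, `m_n` and `X_n = Σ_{j=2}^{n} (m_j − m_{j−1})·nbDilatePrimeSide j`. -/
def step (n : ℕ) (s : ℤ × ℤ × ℤ × ℤ × ℤ × ℤ × ℤ × ℤ) : Option (ℤ × ℤ × ℤ × ℤ × ℤ × ℤ × ℤ × ℤ) :=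
  -- process index `n + 1 ≥ 2`
  match s, lamIv (n + 1), mIv (n + 1) with
  | (Alo, Ahi, Plo, Phi, mlo, mhi, Xlo, Xhi), some (ll, lh), some (ml, mh) =>
    let Alo' := Alo + ll / ((n : ℤ) + 1)
    let Ahi' := Ahi + -((-lh) / ((n : ℤ) + 1))
    let Plo' := Plo + ll
    let Phi' := Phi + lh
    match pIv (n + 1) Alo' Ahi' Plo' Phi' with
    | some (pl, ph) =>
      let wl := max (ml - mhi) 0
      let wh := mh - mlo
      let xl := if 0 ≤ pl then wl * pl / LOGSC else wh * pl / LOGSC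
      let xh := if 0 ≤ ph then -((-(wh * ph)) / LOGSC) else -((-(wl * ph)) / LOGSC)
      some (Alo', Ahi', Plo', Phi', ml, mh, Xlo + xl, Xhi + xh)
    | none => none
  | _, _, _ => none

/-- Run the pass from index `1` (state: `A = Ψ = 0` since `Λ(1) = 0`, `m_1` from `mIv 1`, `X = 0`) through index `K + 1`. -/
def run : ℕ → Option (ℤ × ℤ × ℤ × ℤ × ℤ × ℤ × ℤ × ℤ)
  | 0 => match mIv 1 with
    | some (ml, mh) => some (0, 0, 0, 0, ml, mh, 0, 0)
    | none => none
  | k + 1 => match run k with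
    | some s => step (k + 1) s
    | none => none

/-! ## Soundness -/

/-- **Soundness of `lamIv`.** -/
theorem lamIv_sound {m : ℕ} {lo hi : ℤ} (h : lamIv m = some (lo, hi)) :
    (lo : ℝ) / 2 ^ 80 ≤ (ArithmeticFunction.vonMangoldt m : ℝ) ∧
      (ArithmeticFunction.vonMangoldt m : ℝ) ≤ (hi : ℝ) / 2 ^ 80 := by
  unfold lamIv at h
  rw [ArithmeticFunction.vonMangoldt_apply]
  split_ifs at h with hp
  · rw [if_pos hp]
    exact logIv_sound h
  · rw [if_neg hp]
    simp only [Option.some.injEq, Prod.mk.injEq] at h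
    obtain ⟨rfl, rfl⟩ := h
    simp

/-- **Soundness of `mIv`** (`n ≥ 1`). -/
theorem mIv_sound {n : ℕ} (hn : 1 ≤ n) {lo hi : ℤ} (h : mIv n = some (lo, hi)) :
    (lo : ℝ) / 2 ^ 80 ≤ nbFareyMean n ∧ nbFareyMean n ≤ (hi : ℝ) / 2 ^ 80 := by
  have hS : (0 : ℝ) < (2 : ℝ) ^ 80 := by positivity
  have hm : nbFareyMean n = (n : ℝ) * (n + 1) * Real.log (1 + 1 / n) - n :=
    FareyMean.nbFareyMean_of_pos (by omega)
  unfold mIv at h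
  split_ifs at h with h1
  · -- `n = 1`: `m_1 = 2 log 2 − 1`
    subst h1
    cases hl : logIv 2 with
    | none => simp [hl] at h
    | some q =>
      obtain ⟨l, hh⟩ := q
      simp only [hl, Option.some.injEq, Prod.mk.injEq] at h
      obtain ⟨rfl, rfl⟩ := h
      obtain ⟨h2l, h2h⟩ := logIv_sound hl
      have hm1 : nbFareyMean 1 = 2 * Real.log 2 - 1 := by rw [hm]; norm_num
      rw [hm1]
      push_cast
      rw [QDigits.cast_LOGSC]
      constructor
      · rw [div_le_iff₀ hS]; rw [div_le_iff₀ hS] at h2l; push_cast at h2l; nlinarith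
      · rw [le_div_iff₀ hS]; rw [le_div_iff₀ hS] at h2h; push_cast at h2h; nlinarith
  · cases hl : log1pIv 1 n with
    | none => simp [hl] at h
    | some q =>
      obtain ⟨l, hh⟩ := q
      simp only [hl, Option.some.injEq, Prod.mk.injEq] at h
      obtain ⟨rfl, rfl⟩ := h
      obtain ⟨hl1, hh1⟩ := log1pIv_sound hl
      have hlog1 : Real.log (1 + ((1 : ℕ) : ℝ) / (n : ℕ)) = Real.log (1 + 1 / (n : ℝ)) := by push_cast; rfl
      rw [hlog1] at hl1 hh1
      have hn0 : (0 : ℝ) < n := by exact_mod_cast (show 0 < n by omega)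
      have hN : (0 : ℝ) < (n : ℝ) * ((n : ℝ) + 1) := by positivity
      rw [hm]
      push_cast
      rw [QDigits.cast_LOGSC]
      constructor
      · rw [div_le_iff₀ hS]
        have : (n : ℝ) * ((n : ℝ) + 1) * (l : ℝ) ≤ (n : ℝ) * ((n : ℝ) + 1) * (2 ^ 80 * Real.log (1 + 1 / (n : ℝ))) := by
          refine mul_le_mul_of_nonneg_left ?_ hN.le
          rw [div_le_iff₀ hS] at hl1; linarith
        nlinarith
      · rw [le_div_iff₀ hS]
        have : (n : ℝ) * ((n : ℝ) + 1) * (2 ^ 80 * Real.log (1 + 1 / (n : ℝ))) ≤ (n : ℝ) * ((n : ℝ) + 1) * (hh : ℝ) := by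
          refine mul_le_mul_of_nonneg_left ?_ hN.le
          rw [le_div_iff₀ hS] at hh1; linarith
        nlinarith

/-- Floor bound: `(t / d : ℤ) / 2⁸⁰ ≤ x` whenever `t/2⁸⁰ ≤ x · d`... stated as: for `d > 0`, `((t / d : ℤ) : ℝ) ≤ t / d`. -/
lemma floor_le {t d : ℤ} (hd : 0 < d) : (((t / d : ℤ)) : ℝ) ≤ (t : ℝ) / (d : ℝ) :=
  (ediv_bounds_real t d hd).1

/-- Ceiling bound: `t/d ≤ −((−t)/d)` for `d > 0`. -/
lemma le_ceil {t d : ℤ} (hd : 0 < d) : (t : ℝ) / (d : ℝ) ≤ (((-((-t) / d)) : ℤ) : ℝ) := by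
  have h := (ediv_bounds_real (-t) d hd).1
  push_cast at h ⊢
  have : (-(t : ℝ)) / (d : ℝ) = -((t : ℝ) / d) := by ring
  linarith

/-- The prime side with the logarithms separated: for `n ≥ 2`,
`nbDilatePrimeSide n = A − log n + γ − Ψ/n + 1 + (1 − log 2π)/n − (log(n−1) + log(n+1) − 2 log n)/(2n) − (log(n+1) − log(n−1))/2`. -/
theorem nbDilatePrimeSide_eq_logs {n : ℕ} (hn : 2 ≤ n) :
    nbDilatePrimeSide n =
      (∑ m ∈ Finset.range (n + 1), (ArithmeticFunction.vonMangoldt m : ℝ) / m) - Real.log n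
        + Real.eulerMascheroniConstant
        - (∑ m ∈ Finset.range (n + 1), (ArithmeticFunction.vonMangoldt m : ℝ)) / n + 1
        + (1 - Real.log (2 * Real.pi)) / n
        - (Real.log ((n : ℝ) - 1) + Real.log ((n : ℝ) + 1) - 2 * Real.log n) / (2 * n)
        - (Real.log ((n : ℝ) + 1) - Real.log ((n : ℝ) - 1)) / 2 := by
  have hn' : (2 : ℝ) ≤ n := by exact_mod_cast hn
  have hn0 : (n : ℝ) ≠ 0 := by linarith
  have hm1 : 0 < (n : ℝ) - 1 := by linarith
  have hp1 : 0 < (n : ℝ) + 1 := by linarith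
  have hlog1 : Real.log (1 - 1 / (n : ℝ) ^ 2) = Real.log ((n : ℝ) - 1) + Real.log ((n : ℝ) + 1) - 2 * Real.log n := by
    have e : 1 - 1 / (n : ℝ) ^ 2 = ((n : ℝ) - 1) * ((n : ℝ) + 1) / ((n : ℝ) * n) := by
      field_simp; ring
    rw [e, Real.log_div (by positivity) (by positivity), Real.log_mul hm1.ne' hp1.ne', Real.log_mul hn0 hn0]
    ring
  have hlog2 : Real.log (((n : ℝ) + 1) / ((n : ℝ) - 1)) = Real.log ((n : ℝ) + 1) - Real.log ((n : ℝ) - 1) :=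
    Real.log_div hp1.ne' hm1.ne'
  unfold nbDilatePrimeSide
  rw [hlog1, hlog2]
  field_simp
  ring

/-- **Soundness of `pIv`** (`n ≥ 2`). -/
theorem pIv_sound {n : ℕ} (hn : 2 ≤ n) {Alo Ahi Plo Phi pl ph : ℤ}
    (hA1 : (Alo : ℝ) / 2 ^ 80 ≤ ∑ m ∈ Finset.range (n + 1), (ArithmeticFunction.vonMangoldt m : ℝ) / m)
    (hA2 : ∑ m ∈ Finset.range (n + 1), (ArithmeticFunction.vonMangoldt m : ℝ) / m ≤ (Ahi : ℝ) / 2 ^ 80)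
    (hP1 : (Plo : ℝ) / 2 ^ 80 ≤ ∑ m ∈ Finset.range (n + 1), (ArithmeticFunction.vonMangoldt m : ℝ))
    (hP2 : ∑ m ∈ Finset.range (n + 1), (ArithmeticFunction.vonMangoldt m : ℝ) ≤ (Phi : ℝ) / 2 ^ 80)
    (h : pIv n Alo Ahi Plo Phi = some (pl, ph)) :
    (pl : ℝ) / 2 ^ 80 ≤ nbDilatePrimeSide n ∧ nbDilatePrimeSide n ≤ (ph : ℝ) / 2 ^ 80 := by
  have hS : (0 : ℝ) < (2 : ℝ) ^ 80 := by positivity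
  have hn' : (2 : ℝ) ≤ n := by exact_mod_cast hn
  have hn0 : (0 : ℝ) < n := by linarith
  have hnZ : (0 : ℤ) < n := by exact_mod_cast (show 0 < n by omega)
  have h2nZ : (0 : ℤ) < 2 * (n : ℤ) := by linarith
  unfold pIv at h
  cases ha : logIv (n - 1) with
  | none => simp only [ha] at h; simp at h
  | some qa =>
    obtain ⟨al, ah⟩ := qa
    cases hb : logIv n with
    | none => simp only [ha, hb] at h; simp at h
    | some qb =>
      obtain ⟨bl, bh⟩ := qb
      cases hc : logIv (n + 1) with
      | none => simp only [ha, hb, hc] at h; simp at h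
      | some qc =>
        obtain ⟨cl, ch⟩ := qc
        simp only [ha, hb, hc, Option.some.injEq, Prod.mk.injEq] at h
        obtain ⟨hpl, hph⟩ := h
        obtain ⟨hal, hah⟩ := logIv_sound ha
        obtain ⟨hbl, hbh⟩ := logIv_sound hb
        obtain ⟨hcl, hch⟩ := logIv_sound hc
        have ecast1 : (((n - 1 : ℕ)) : ℝ) = (n : ℝ) - 1 := by
          rw [Nat.cast_sub (by omega)]; simp
        have ecast2 : (((n + 1 : ℕ)) : ℝ) = (n : ℝ) + 1 := by push_cast; ring
        rw [ecast1] at hal hah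
        rw [ecast2] at hcl hch
        set A := ∑ m ∈ Finset.range (n + 1), (ArithmeticFunction.vonMangoldt m : ℝ) / m with hAdef
        set Ψ := ∑ m ∈ Finset.range (n + 1), (ArithmeticFunction.vonMangoldt m : ℝ) with hΨdef
        set La := Real.log ((n : ℝ) - 1) with hLa
        set Lb := Real.log (n : ℝ) with hLb
        set Lc := Real.log ((n : ℝ) + 1) with hLc
        rw [nbDilatePrimeSide_eq_logs hn]
        -- real constants
        have hglo := Literature.Analysis.SpecialFunctions.Real.eulerMascheroniConstant_gt_d16
        have hghi := Literature.Analysis.SpecialFunctions.Real.eulerMascheroniConstant_lt_d16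
        have hl2lo := Literature.Analysis.SpecialFunctions.Real.log_two_gt_d20
        have hl2hi := Literature.Analysis.SpecialFunctions.Real.log_two_lt_d20
        have hlpilo := Literature.Analysis.SpecialFunctions.Real.log_pi_gt_d20
        have hlpihi := Literature.Analysis.SpecialFunctions.Real.log_pi_lt_d20
        have hlog2pi : Real.log (2 * Real.pi) = Real.log 2 + Real.log Real.pi :=
          Real.log_mul two_ne_zero Real.pi_pos.ne'
        have hGLO : ((GLO : ℤ) : ℝ) ≤ 2 ^ 80 * Real.eulerMascheroniConstant := by
          have h1 : ((GLO : ℤ) : ℝ) ≤ (0.5772156649015328 : ℝ) * 2 ^ 80 := by norm_num [GLO]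
          linarith
        have hGHI : 2 ^ 80 * Real.eulerMascheroniConstant ≤ ((GHI : ℤ) : ℝ) := by
          have h1 : (0.5772156649015405 : ℝ) * 2 ^ 80 ≤ ((GHI : ℤ) : ℝ) := by norm_num [GHI]
          linarith
        have hL2PILO : ((L2PILO : ℤ) : ℝ) ≤ 2 ^ 80 * Real.log (2 * Real.pi) := by
          have h1 : ((L2PILO : ℤ) : ℝ) ≤ ((0.69314718055994530940 : ℝ) + 1.14472988584940017414) * 2 ^ 80 := by
            norm_num [L2PILO]
          rw [hlog2pi]; linarith
        have hL2PIHI : 2 ^ 80 * Real.log (2 * Real.pi) ≤ ((L2PIHI : ℤ) : ℝ) := by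
          have h1 : ((0.69314718055994530944 : ℝ) + 1.14472988584940017415) * 2 ^ 80 ≤ ((L2PIHI : ℤ) : ℝ) := by
            norm_num [L2PIHI]
          rw [hlog2pi]; linarith
        -- scaled real versions of the enclosed quantities
        have hA1' : (Alo : ℝ) ≤ 2 ^ 80 * A := by rw [div_le_iff₀ hS] at hA1; linarith
        have hA2' : 2 ^ 80 * A ≤ (Ahi : ℝ) := by rw [le_div_iff₀ hS] at hA2; linarith
        have hP1' : (Plo : ℝ) ≤ 2 ^ 80 * Ψ := by rw [div_le_iff₀ hS] at hP1; linarith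
        have hP2' : 2 ^ 80 * Ψ ≤ (Phi : ℝ) := by rw [le_div_iff₀ hS] at hP2; linarith
        have hal' : (al : ℝ) ≤ 2 ^ 80 * La := by rw [div_le_iff₀ hS] at hal; linarith
        have hah' : 2 ^ 80 * La ≤ (ah : ℝ) := by rw [le_div_iff₀ hS] at hah; linarith
        have hbl' : (bl : ℝ) ≤ 2 ^ 80 * Lb := by rw [div_le_iff₀ hS] at hbl; linarith
        have hbh' : 2 ^ 80 * Lb ≤ (bh : ℝ) := by rw [le_div_iff₀ hS] at hbh; linarith
        have hcl' : (cl : ℝ) ≤ 2 ^ 80 * Lc := by rw [div_le_iff₀ hS] at hcl; linarith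
        have hch' : 2 ^ 80 * Lc ≤ (ch : ℝ) := by rw [le_div_iff₀ hS] at hch; linarith
        -- the integer divisions
        have hnR : ((n : ℤ) : ℝ) = (n : ℝ) := by simp
        have h2nR : (((2 * (n : ℤ)) : ℤ) : ℝ) = 2 * (n : ℝ) := by push_cast; ring
        have h2R : (((2 : ℤ)) : ℝ) = 2 := by norm_num
        -- Ψ/n
        have d1 := le_ceil (t := -Phi) hnZ   -- unused shape helper
        have e1lo : ((((-((-Phi) / (n : ℤ))) : ℤ)) : ℝ) ≥ (Phi : ℝ) / (n : ℝ) := by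
          have := le_ceil (t := Phi) hnZ; rw [hnR] at this; exact this
        have e1hi : ((((Plo / (n : ℤ)) : ℤ)) : ℝ) ≤ (Plo : ℝ) / (n : ℝ) := by
          have := floor_le (t := Plo) hnZ; rw [hnR] at this; exact this
        -- (S − L2PI)/n
        have e2lo : ((((LOGSC - L2PIHI) / (n : ℤ)) : ℤ) : ℝ) ≤ (((LOGSC - L2PIHI : ℤ)) : ℝ) / (n : ℝ) := by
          have := floor_le (t := LOGSC - L2PIHI) hnZ; rw [hnR] at this; exact this
        have e2hi : (((LOGSC - L2PILO : ℤ)) : ℝ) / (n : ℝ) ≤ ((((-((-(LOGSC - L2PILO)) / (n : ℤ))) : ℤ)) : ℝ) := by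
          have := le_ceil (t := LOGSC - L2PILO) hnZ; rw [hnR] at this; exact this
        -- bracket/(2n)
        have e3lo : (((ah + ch - 2 * bl : ℤ)) : ℝ) / (2 * (n : ℝ)) ≤ ((((-((-(ah + ch - 2 * bl)) / (2 * (n : ℤ)))) : ℤ)) : ℝ) := by
          have := le_ceil (t := ah + ch - 2 * bl) h2nZ; rw [h2nR] at this; exact this
        have e3hi : ((((al + cl - 2 * bh) / (2 * (n : ℤ))) : ℤ) : ℝ) ≤ (((al + cl - 2 * bh : ℤ)) : ℝ) / (2 * (n : ℝ)) := by
          have := floor_le (t := al + cl - 2 * bh) h2nZ; rw [h2nR] at this; exact this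
        -- last/2
        have e4lo : (((ch - al : ℤ)) : ℝ) / 2 ≤ ((((-((-(ch - al)) / 2)) : ℤ)) : ℝ) := by
          have := le_ceil (t := ch - al) (d := 2) (by norm_num); rw [h2R] at this; exact this
        have e4hi : ((((cl - ah) / 2) : ℤ) : ℝ) ≤ (((cl - ah : ℤ)) : ℝ) / 2 := by
          have := floor_le (t := cl - ah) (d := 2) (by norm_num); rw [h2R] at this; exact this
        -- real-valued comparison of each bracket
        have hSL : ((LOGSC : ℤ) : ℝ) = 2 ^ 80 := QDigits.cast_LOGSC
        constructor
        · rw [← hpl, div_le_iff₀ hS]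
          push_cast
          rw [hSL]
          push_cast at e1lo e2lo e3lo e4lo
          rw [hSL] at e2lo
          -- Ψ/n term
          have t1 : (Phi : ℝ) / (n : ℝ) ≥ 2 ^ 80 * Ψ / n := div_le_div_of_nonneg_right hP2' hn0.le
          have t2 : ((2 : ℝ) ^ 80 - (L2PIHI : ℝ)) / (n : ℝ) ≤ 2 ^ 80 * (1 - Real.log (2 * Real.pi)) / n :=
            div_le_div_of_nonneg_right (by linarith) hn0.le
          have t3 : 2 ^ 80 * (La + Lc - 2 * Lb) / (2 * n) ≤ ((ah : ℝ) + ch - 2 * bl) / (2 * (n : ℝ)) :=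
            div_le_div_of_nonneg_right (by linarith) (by linarith)
          have t4 : 2 ^ 80 * (Lc - La) / 2 ≤ ((ch : ℝ) - al) / 2 :=
            div_le_div_of_nonneg_right (by linarith) (by norm_num)
          have eS : (A - Lb + Real.eulerMascheroniConstant - Ψ / ↑n + 1 + (1 - Real.log (2 * Real.pi)) / ↑n -
              (La + Lc - 2 * Lb) / (2 * ↑n) - (Lc - La) / 2) * 2 ^ 80 =
              2 ^ 80 * A - 2 ^ 80 * Lb + 2 ^ 80 * Real.eulerMascheroniConstant - 2 ^ 80 * Ψ / n + 2 ^ 80 +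
              2 ^ 80 * (1 - Real.log (2 * Real.pi)) / n - 2 ^ 80 * (La + Lc - 2 * Lb) / (2 * n) -
              2 ^ 80 * (Lc - La) / 2 := by ring
          rw [eS]
          linarith
        · rw [← hph, le_div_iff₀ hS]
          push_cast
          rw [hSL]
          push_cast at e1hi e2hi e3hi e4hi
          rw [hSL] at e2hi
          have t1 : (Plo : ℝ) / (n : ℝ) ≤ 2 ^ 80 * Ψ / n := div_le_div_of_nonneg_right hP1' hn0.le
          have t2 : 2 ^ 80 * (1 - Real.log (2 * Real.pi)) / n ≤ ((2 : ℝ) ^ 80 - (L2PILO : ℝ)) / (n : ℝ) :=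
            div_le_div_of_nonneg_right (by linarith) hn0.le
          have t3 : ((al : ℝ) + cl - 2 * bh) / (2 * (n : ℝ)) ≤ 2 ^ 80 * (La + Lc - 2 * Lb) / (2 * n) :=
            div_le_div_of_nonneg_right (by linarith) (by linarith)
          have t4 : ((cl : ℝ) - ah) / 2 ≤ 2 ^ 80 * (Lc - La) / 2 :=
            div_le_div_of_nonneg_right (by linarith) (by norm_num)
          have eS : (A - Lb + Real.eulerMascheroniConstant - Ψ / ↑n + 1 + (1 - Real.log (2 * Real.pi)) / ↑n -
              (La + Lc - 2 * Lb) / (2 * ↑n) - (Lc - La) / 2) * 2 ^ 80 =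
              2 ^ 80 * A - 2 ^ 80 * Lb + 2 ^ 80 * Real.eulerMascheroniConstant - 2 ^ 80 * Ψ / n + 2 ^ 80 +
              2 ^ 80 * (1 - Real.log (2 * Real.pi)) / n - 2 ^ 80 * (La + Lc - 2 * Lb) / (2 * n) -
              2 ^ 80 * (Lc - La) / 2 := by ring
          rw [eS]
          linarith

end KappaCert

end Summit.RiemannHypothesis.RiemannHypothesis.Theorems.NbTheory

end
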